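import Literature.Analysis.FluidPDE.ClassicalCurlPairDuality
import Literature.Analysis.FluidPDE.OseenTensorForceDuhamel
import Literature.Analysis.FluidPDE.OseenDuhamelLimits
import Literature.Analysis.FluidPDE.DivCurlLiouvilleBounded
import Literature.Analysis.FluidPDE.ClassicalSolutionCalculus
import Literature.Analysis.FluidPDE.SelfSimilar
import HarnessLib

/-!
# Type-I ancient classical solutions with a defect force are forced Oseen-mild up to an
# `O(ε √lag)` remainder

Analysis/FluidPDE proof file (everything proved; no definitions, no named facts) closing the
literature side of the *forced local compactness* step of the Koch–Nadirashvili–Seregin–Šverák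
Liouville programme (Acta Math. 203 (2009) = arXiv:0709.3599, §4 (i) with Lemma 3.1 / Remark 3.1
and the mildness argument of the proof of Thm. 6.1, p. 12): a classical solution `(u, p)` of
`∂ₜu + (u·∇)u = νΔu − ∇p + d`, `div u = 0` on `ℝ³ × (−∞, 0)` with the **Type-I bound**
`‖u(t, x)‖ ≤ C₀ (‖x‖ + √(−t))⁻¹` (KNSS (1.6)) and a **defect force** of Type-I weight
`‖d(τ, y)‖ ≤ ε (‖y‖ + √(−τ))⁻³` (the weight of `(u·∇)u`) satisfies, for all `s < t < 0` and
**every** `x`,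

  `‖u(t, x) − e^{ν(t−s)Δ}u(s)(x) + B^ν_s(u,u)(t)(x)‖ ≤ 2 κ ε √(t − s) / (√ν (−t))`

with a universal `κ` (`norm_sub_heatExtension_add_oseenDuhamel_le_of_typeI`), and in fact
`u(t) − e^{ν(t−s)Δ}u(s) + B^ν_s(u,u)(t) = ∫ₛᵗ e^{ν(t−τ)Δ}ℙ d(τ) dτ + c` with a constant
`‖c‖ ≤ κ ε √(t−s)/(√ν(−t))` (`exists_const_forced_oseenMild_of_typeI`). For `ε = 0` this is the
Oseen integral equation of a Type-I ancient (mild) solution. The proof is the printed one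
(KNSS 2009, proof of Lemma 3.1 and of Thm. 6.1, last paragraph), assembled from tree results:

1. **no pressure is needed**: the classical solution satisfies the duality identity against the
   curl-type test fields `(∂ₐg)c − (∂_c g)a`, between any two times
   (`IsClassicalNSSolutionOn.curlPair_duality_between`, `ClassicalCurlPairDuality.lean`);
2. the free term, the bilinear Duhamel term (`integral_inner_oseenDuhamel_eq_neg_intervalIntegral`)
   and the force term `oseenForceDuhamel ν s d t` (`integral_inner_oseenForceDuhamel_of_isDivFree`,
   `OseenTensorForceDuhamel.lean`) have the matching tested forms, so
   `z = u(t) − e^{ν(t−s)Δ}u(s) + B^ν_s(u,u)(t) − ∫ₛᵗ e^{ν(t−τ)Δ}ℙd` is continuous, bounded, weakly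
   divergence free and annihilates the curl-type fields, hence **constant** (Liouville for the
   `div`–`curl` system, KNSS Lemma 3.1 p. 7:
   `IsWeaklyDivFree.exists_eq_const_of_continuous_of_forall_integral_inner_curlPair_eq_zero`);
3. **the decay bounds the constant** (KNSS p. 12, "it follows easily that `b` must vanish"): along
   `xₙ = n e₁` the three terms `u(t, xₙ)`, `e^{ν(t−s)Δ}u(s)(xₙ)`, `B^ν_s(u,u)(t)(xₙ)` tend to `0`
   (Type I; dominated convergence of translates, `tendsto_heatExtension_of_tendsto_of_bound`,
   `tendsto_oseenDuhamel_of_tendsto_of_bound`), so `‖c‖ ≤ sup ‖∫ₛᵗ e^{ν(t−τ)Δ}ℙd‖ ≤ κε√(t−s)/(√ν(−t))`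
   (`exists_norm_oseenForceDuhamel_le_of_weight`, KNSS (4.5) with the weight (1.6)).

The `ν = 1` corollary `forcedOseenMild_remainder_typeI` is stated in the shape consumed by the
angular-Galerkin compactness engine (`Φ(t) = 2κ/(−t)` monotone on `(−∞,0)`,
`K(s,t) = 2κ√(t−s)/(−t)`).

## References

* G. Koch, N. Nadirashvili, G. Seregin, V. Šverák, *Liouville theorems for the Navier–Stokes
  equations and applications*, Acta Math. 203 (2009) 83–105 = arXiv:0709.3599: §1 (1.6), Lemma
  3.1 / Remark 3.1 (p. 7), §4 (i) (4.3)–(4.5) (p. 8), proof of Thm. 6.1, last paragraph (p. 12).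
  [KochNadirashviliSereginSverak2009]
* P. G. Lemarié-Rieusset, *The Navier–Stokes problem in the 21st century*, CRC Press 2016,
  Thm. 6.1 ((6.12) ⇔ (6.11)), §6.2. [LemarieRieusset2016]
-/

noncomputable section

open MeasureTheory Set Function Filter TopologicalSpace Metric
open _root_.Topology
open scoped InnerProductSpace RealInnerProductSpace NNReal ENNReal

namespace Literature.Analysis.FluidPDE

/-! ### Translates and Type-I decay -/

section Translate

variable {F : Type*} [NormedAddCommGroup F] [NormedSpace ℝ F]

/-- Translation covariance of the caloric extension (local copy of
`heatExtension_comp_add_right`, `KatoSymmetryCovariance.lean`, not imported):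
`e^{σΔ}(g(· + a))(x) = e^{σΔ}g(x + a)`. [folklore] -/
private theorem heatExtension_comp_add_right' (g : EuclideanSpace ℝ (Fin 3) → F)
    (a : EuclideanSpace ℝ (Fin 3)) (σ : ℝ) (x : EuclideanSpace ℝ (Fin 3)) :
    UnboundedOperators.heatExtension (fun y => g (y + a)) σ x =
      UnboundedOperators.heatExtension g σ (x + a) := by
  simp only [UnboundedOperators.heatExtension_apply]
  refine integral_congr_ae (Eventually.of_forall fun y => ?_)
  simp only [sub_add_eq_add_sub]

/-- Translation covariance of the Duhamel term (local copy of `oseenDuhamel_comp_add_right`,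
`KNSSOseenMildDecayTools.lean`, not imported):
`B^ν_s(u(·, · + a), v(·, · + a))(t)(x) = B^ν_s(u, v)(t)(x + a)`. [folklore] -/
private theorem oseenDuhamel_comp_add_right' (ν s : ℝ)
    (u v : ℝ → EuclideanSpace ℝ (Fin 3) → EuclideanSpace ℝ (Fin 3)) (a : EuclideanSpace ℝ (Fin 3))
    (t : ℝ) (x : EuclideanSpace ℝ (Fin 3)) :
    oseenDuhamel ν s (fun τ y => u τ (y + a)) (fun τ y => v τ (y + a)) t x =
      oseenDuhamel ν s u v t (x + a) := by
  simp only [oseenDuhamel_apply]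
  refine setIntegral_congr_fun measurableSet_Ioo fun τ _ => ?_
  rw [← integral_add_right_eq_self
    (fun y => oseenKernel (ν * (t - τ)) (x + a - y) (u τ y) (v τ y)) a]
  refine integral_congr_ae (Eventually.of_forall fun y => ?_)
  simp only [add_sub_add_right_eq_sub]

omit [NormedSpace ℝ F] in
/-- **Translates of a field with a Type-I-type bound tend to zero**: if `‖g(y)‖ ≤ C/(‖y‖ + a)`
with `a > 0`, then `g(y + n e₁) → 0` as `n → ∞` for every `y` (since `‖y + n e₁‖ ≥ n − ‖y‖`).
[folklore] -/
private theorem tendsto_translate_axis_of_decay {g : EuclideanSpace ℝ (Fin 3) → F} {C a : ℝ}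
    (ha : 0 < a) (hg : ∀ y, ‖g y‖ ≤ C / (‖y‖ + a)) (y : EuclideanSpace ℝ (Fin 3)) :
    Tendsto (fun n : ℕ =>
      g (y + (n : ℝ) • (EuclideanSpace.single 0 1 : EuclideanSpace ℝ (Fin 3)))) atTop (𝓝 0) := by
  set e₁ : EuclideanSpace ℝ (Fin 3) := EuclideanSpace.single 0 1 with he₁
  have he : ‖e₁‖ = 1 := by
    rw [he₁, PiLp.norm_single (2 : ℝ≥0∞) (fun _ : Fin 3 => ℝ) (0 : Fin 3) (1 : ℝ), norm_one]
  have hC : 0 ≤ C := by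
    have h := (norm_nonneg _).trans (hg 0)
    rw [norm_zero, zero_add] at h
    exact (div_nonneg_iff.1 h).elim (fun h => h.1) fun h => absurd h.2 (not_le.2 ha)
  -- `‖y + n e₁‖ + a ≥ n − ‖y‖ + a`
  have hrad : ∀ n : ℕ, (n : ℝ) - ‖y‖ + a ≤ ‖y + (n : ℝ) • e₁‖ + a := by
    intro n
    have h1 : ‖(n : ℝ) • e₁‖ = n := by rw [norm_smul, he, mul_one, Real.norm_natCast]
    have h2 : ‖(n : ℝ) • e₁‖ ≤ ‖y + (n : ℝ) • e₁‖ + ‖y‖ := by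
      have := norm_sub_le (y + (n : ℝ) • e₁) y
      rwa [add_sub_cancel_left] at this
    linarith
  refine squeeze_zero_norm' ?_ ((tendsto_const_nhds (x := C)).div_atTop
    (tendsto_atTop_add_const_right _ (-‖y‖ + a) tendsto_natCast_atTop_atTop))
  filter_upwards [eventually_gt_atTop (⌈‖y‖⌉₊ : ℕ)] with n hn
  have hn' : ‖y‖ < n := (Nat.le_ceil _).trans_lt (by exact_mod_cast hn)
  have hpos : 0 < (n : ℝ) - ‖y‖ + a := by linarith
  rw [show (n : ℝ) + (-‖y‖ + a) = (n : ℝ) - ‖y‖ + a by ring]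
  exact (hg _).trans (div_le_div_of_nonneg_left hC hpos (hrad n))

end Translate

/-! ### The forced Oseen identity up to a bounded constant -/

section Main

variable {ν C₀ ε : ℝ} {u d : ℝ → EuclideanSpace ℝ (Fin 3) → EuclideanSpace ℝ (Fin 3)}
  {p : ℝ → EuclideanSpace ℝ (Fin 3) → ℝ}

/-- **Type-I ancient classical solutions with a defect force are forced Oseen-mild up to a
constant bounded by the force term** (KNSS 2009, Lemma 3.1 / Remark 3.1 with §4 (i) and the last
paragraph of the proof of Thm. 6.1): with the universal `κ` of
`exists_norm_oseenForceDuhamel_le_of_weight`, for every classical solution `(u, p)` of the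
Navier–Stokes system with viscosity `ν > 0` and force `d` on `ℝ³ × (−∞, 0)` satisfying the Type-I
bound `‖u(t,x)‖ ≤ C₀/(‖x‖ + √(−t))` and the defect bound `‖d(τ,y)‖ ≤ ε/(‖y‖ + √(−τ))³`, and all
`s < t < 0`, there is a constant vector `c` with `‖c‖ ≤ κ ε √(t−s)/(√ν(−t))` and
`u(t, x) − e^{ν(t−s)Δ}u(s)(x) + B^ν_s(u,u)(t)(x) = (∫ₛᵗ e^{ν(t−τ)Δ}ℙd(τ)dτ)(x) + c` for every `x`.
[cite: KochNadirashviliSereginSverak2009, Lemma 3.1 / Remark 3.1 (p. 7), §4 (i) (4.3)–(4.5), proof of Thm. 6.1 last paragraph (p. 12)] -/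
theorem exists_const_forced_oseenMild_of_typeI :
    ∃ κ : ℝ, 0 < κ ∧ ∀ {ν C₀ ε : ℝ} {u d : ℝ → EuclideanSpace ℝ (Fin 3) → EuclideanSpace ℝ (Fin 3)}
      {p : ℝ → EuclideanSpace ℝ (Fin 3) → ℝ},
      IsClassicalNSSolutionOn (Iio 0) ν d u p → 0 < ν → HasTypeIDecay C₀ u →
      (∀ τ < 0, ∀ y, ‖d τ y‖ ≤ ε / (‖y‖ + Real.sqrt (-τ)) ^ 3) →
      ∀ ⦃s t : ℝ⦄, s < t → t < 0 → ∃ c : EuclideanSpace ℝ (Fin 3),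
        ‖c‖ ≤ κ * ε * Real.sqrt (t - s) / (Real.sqrt ν * (-t)) ∧
        ∀ x, u t x - UnboundedOperators.heatExtension (u s) (ν * (t - s)) x + oseenDuhamel ν s u u t x =
          oseenForceDuhamel ν s d t x + c := by
  obtain ⟨κ, hκ, hF⟩ := exists_norm_oseenForceDuhamel_le_of_weight
  refine ⟨κ, hκ, fun {ν C₀ ε u d p} hcl hν hI hd s t hst ht => ?_⟩
  haveI : CompleteSpace (EuclideanSpace ℝ (Fin 3)) := FiniteDimensional.complete ℝ _
  -- ## constants and elementary bounds
  have ht0 : 0 < -t := neg_pos.2 ht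
  have hst' : 0 < t - s := sub_pos.2 hst
  have hνts : 0 < ν * (t - s) := mul_pos hν hst'
  have hsqt : 0 < Real.sqrt (-t) := Real.sqrt_pos.2 ht0
  have hC₀ : 0 ≤ C₀ := by
    have h := (norm_nonneg _).trans (hI t ht 0)
    rw [norm_zero, zero_add] at h
    exact (div_nonneg_iff.1 h).elim (fun h => h.1) fun h => absurd h.2 (not_le.2 hsqt)
  have hε : 0 ≤ ε := by
    have h1 := (norm_nonneg _).trans (hd (-1) (by norm_num) 0)
    have h2 : (0 : ℝ) < (‖(0 : (EuclideanSpace ℝ (Fin 3)))‖ + Real.sqrt (-(-1 : ℝ))) ^ 3 := by simp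
    exact (div_nonneg_iff.1 h1).elim (fun h => h.1) fun h => absurd h.2 (not_le.2 h2)
  set M : ℝ := C₀ / Real.sqrt (-t) with hM
  have hM0 : 0 ≤ M := by positivity
  -- the Type-I bound gives `‖u τ y‖ ≤ M` for `τ ≤ t`
  have hbdM : ∀ τ, τ ≤ t → ∀ y, ‖u τ y‖ ≤ M := by
    intro τ hτ y
    have hτ0 : τ < 0 := hτ.trans_lt ht
    have h1 := hI τ hτ0 y
    have hsq : Real.sqrt (-t) ≤ Real.sqrt (-τ) := Real.sqrt_le_sqrt (by linarith)
    calc ‖u τ y‖ ≤ C₀ / (‖y‖ + Real.sqrt (-τ)) := h1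
      _ ≤ C₀ / Real.sqrt (-t) :=
          div_le_div_of_nonneg_left hC₀ hsqt (by linarith [norm_nonneg y])
  -- the defect bound gives `‖d τ y‖ ≤ ε / √(-t)^3` for `τ ≤ t`
  have hbdD : ∀ τ, τ ≤ t → ∀ y, ‖d τ y‖ ≤ ε / Real.sqrt (-t) ^ 3 := by
    intro τ hτ y
    have hτ0 : τ < 0 := hτ.trans_lt ht
    have hsq : Real.sqrt (-t) ≤ Real.sqrt (-τ) := Real.sqrt_le_sqrt (by linarith)
    exact (hd τ hτ0 y).trans (div_le_div_of_nonneg_left hε (by positivity)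
      (pow_le_pow_left₀ hsqt.le (by linarith [norm_nonneg y]) 3))
  -- ## regularity of `u` and `d`
  have hUD : UniqueDiffOn ℝ (Iio (0 : ℝ)) := uniqueDiffOn_Iio 0
  have hcont : ContinuousOn (uncurry u) (Iio 0 ×ˢ univ) := hcl.smooth_velocity.continuousOn
  have hslice : ∀ τ < 0, Continuous (u τ) := fun τ hτ =>
    hcont.comp_continuous (Continuous.prodMk_right τ) fun x => ⟨hτ, mem_univ x⟩
  have hdc : ContinuousOn (uncurry d) (Iio 0 ×ˢ univ) := hcl.continuousOn_force hUD
  have hmeas_tr : ∀ (x' : EuclideanSpace ℝ (Fin 3)),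
      AEStronglyMeasurable (uncurry fun σ y => u σ (y + x'))
        ((volume : Measure (ℝ × EuclideanSpace ℝ (Fin 3))).restrict (Ioo s t ×ˢ univ)) := by
    intro x'
    have hc : ContinuousOn (uncurry fun σ y => u σ (y + x')) (Ioo s t ×ˢ univ) := by
      refine (hcont.comp (continuous_fst.prodMk (continuous_snd.add continuous_const)).continuousOn
        fun q hq => ⟨?_, mem_univ _⟩)
      exact (show q.1 < t from hq.1.2).trans ht
    exact hc.aestronglyMeasurable (measurableSet_Ioo.prod MeasurableSet.univ)
  have hmeas : AEStronglyMeasurable (uncurry u)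
      ((volume : Measure (ℝ × EuclideanSpace ℝ (Fin 3))).restrict (Ioo s t ×ˢ univ)) := by
    simpa using hmeas_tr 0
  have huM : ∀ τ ∈ Ioo s t, ∀ y, ‖u τ y‖ ≤ M := fun τ hτ y => hbdM τ hτ.2.le y
  -- ## the four fields
  set H : EuclideanSpace ℝ (Fin 3) → EuclideanSpace ℝ (Fin 3) :=
    UnboundedOperators.heatExtension (u s) (ν * (t - s)) with hH
  set B : EuclideanSpace ℝ (Fin 3) → EuclideanSpace ℝ (Fin 3) := oseenDuhamel ν s u u t with hB
  set Fd : EuclideanSpace ℝ (Fin 3) → EuclideanSpace ℝ (Fin 3) := oseenForceDuhamel ν s d t with hFd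
  have hut_c : Continuous (u t) := hslice t ht
  have hH_c : Continuous H :=
    (UnboundedOperators.contDiff_heatExtension_of_bound (hslice s (hst.trans ht)) (hbdM s hst.le)
      hνts (m := 0)).continuous
  have hB_c : Continuous B :=
    continuous_oseenDuhamel_slice hν hM0 hmeas hmeas huM huM hst le_rfl
  have hFd_c : Continuous Fd := continuous_oseenForceDuhamel_of_weight hν hdc hd s ht
  -- bounds
  have hut_bd : ∀ x, ‖u t x‖ ≤ M := hbdM t le_rfl
  have hH_bd : ∀ x, ‖H x‖ ≤ M := fun x =>
    UnboundedOperators.norm_heatExtension_le (hbdM s hst.le) hνts x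
  obtain ⟨CB, hCB, hCBle⟩ := exists_norm_oseenDuhamel_bounded_le (E := EuclideanSpace ℝ (Fin 3))
  have hB_bd : ∀ x, ‖B x‖ ≤ CB * M ^ 2 * ν ^ (-(1 / 2 : ℝ)) * (2 * Real.sqrt (t - s)) := fun x =>
    hCBle hν hst hM0 huM huM x
  set KF : ℝ := κ * ε * Real.sqrt (t - s) / (Real.sqrt ν * (-t)) with hKF
  have hFd_bd : ∀ x, ‖Fd x‖ ≤ KF := fun x => hF hν d hd hst ht x
  -- ## the field `z = u t − H + B − Fd`
  set z : EuclideanSpace ℝ (Fin 3) → EuclideanSpace ℝ (Fin 3) :=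
    fun x => u t x - H x + B x - Fd x with hz
  have hz_c : Continuous z := ((hut_c.sub hH_c).add hB_c).sub hFd_c
  have hz_bd : ∀ x, ‖z x‖ ≤ M + M + CB * M ^ 2 * ν ^ (-(1 / 2 : ℝ)) * (2 * Real.sqrt (t - s)) + KF := by
    intro x
    calc ‖z x‖ ≤ ‖u t x - H x + B x‖ + ‖Fd x‖ := norm_sub_le _ _
      _ ≤ (‖u t x - H x‖ + ‖B x‖) + ‖Fd x‖ := by gcongr; exact norm_add_le _ _
      _ ≤ ((‖u t x‖ + ‖H x‖) + ‖B x‖) + ‖Fd x‖ := by gcongr; exact norm_sub_le _ _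
      _ ≤ ((M + M) + CB * M ^ 2 * ν ^ (-(1 / 2 : ℝ)) * (2 * Real.sqrt (t - s))) + KF := by
          gcongr
          · exact hut_bd x
          · exact hH_bd x
          · exact hB_bd x
          · exact hFd_bd x
  -- splitting of pairings with continuous compactly supported fields
  have hsplit : ∀ ψ : EuclideanSpace ℝ (Fin 3) → EuclideanSpace ℝ (Fin 3), Continuous ψ →
      HasCompactSupport ψ →
      ∫ x, ⟪z x, ψ x⟫ = (∫ x, ⟪u t x, ψ x⟫) - (∫ x, ⟪H x, ψ x⟫) + (∫ x, ⟪B x, ψ x⟫) -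
        ∫ x, ⟪Fd x, ψ x⟫ := by
    intro ψ hψ hψc
    have i1 := integrable_inner_of_hasCompactSupport_right hut_c hψ hψc
    have i2 := integrable_inner_of_hasCompactSupport_right hH_c hψ hψc
    have i3 := integrable_inner_of_hasCompactSupport_right hB_c hψ hψc
    have i4 := integrable_inner_of_hasCompactSupport_right hFd_c hψ hψc
    have i12 : Integrable (fun x => ⟪u t x, ψ x⟫ - ⟪H x, ψ x⟫) := i1.sub i2
    have i123 : Integrable (fun x => ⟪u t x, ψ x⟫ - ⟪H x, ψ x⟫ + ⟪B x, ψ x⟫) := i12.add i3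
    simp only [hz, inner_sub_left, inner_add_left]
    rw [integral_sub i123 i4, integral_add i12 i3, integral_sub i1 i2]
  -- ## weak divergence freeness of `z`
  have hdiv_ut : IsWeaklyDivFree (u t) :=
    VectorCalculus.IsDivFree.isWeaklyDivFree_holds (hcl.divFree t ht)
      ((hcl.contDiff_velocity ht).of_le (by norm_cast))
  have hdiv_us : IsWeaklyDivFree (u s) :=
    VectorCalculus.IsDivFree.isWeaklyDivFree_holds (hcl.divFree s (hst.trans ht))
      ((hcl.contDiff_velocity (hst.trans ht)).of_le (by norm_cast))
  have hdiv_H : IsWeaklyDivFree H :=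
    hdiv_us.heatExtension_of_bound (hslice s (hst.trans ht)).aestronglyMeasurable (hbdM s hst.le) hνts
  have hdiv_B : IsWeaklyDivFree B := isWeaklyDivFree_oseenDuhamel hν hmeas hmeas hM0 huM huM hst le_rfl
  have hdiv_Fd : IsWeaklyDivFree Fd := isWeaklyDivFree_oseenForceDuhamel hν hdc hd s ht
  have hz_div : IsWeaklyDivFree z := by
    intro θ hθ
    have hgc : Continuous (gradient θ) :=
      (InnerProductSpace.toDual ℝ (EuclideanSpace ℝ (Fin 3))).symm.continuous.comp
        (hθ.contDiff.continuous_fderiv (by simp))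
    have hgs : HasCompactSupport (gradient θ) :=
      (hθ.hasCompactSupport.fderiv (𝕜 := ℝ)).comp_left
        (g := (InnerProductSpace.toDual ℝ (EuclideanSpace ℝ (Fin 3))).symm) (map_zero _)
    rw [hsplit _ hgc hgs, hdiv_ut θ hθ, hdiv_H θ hθ, hdiv_B θ hθ, hdiv_Fd θ hθ]
    ring
  -- ## `z` annihilates the curl-type test fields
  have hz_curl : ∀ g : EuclideanSpace ℝ (Fin 3) → ℝ, FunctionSpaces.IsTestFunctionOn (⊤ : Opens _) g →
      ∀ a c : EuclideanSpace ℝ (Fin 3),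
      ∫ x, ⟪z x, fderiv ℝ g x a • c - fderiv ℝ g x c • a⟫ = 0 := by
    intro g hg a c
    set φ : EuclideanSpace ℝ (Fin 3) → EuclideanSpace ℝ (Fin 3) :=
      fun x => fderiv ℝ g x a • c - fderiv ℝ g x c • a with hφ
    have hφt : FunctionSpaces.IsTestFunctionOn (⊤ : Opens _) φ := isTestFunctionOn_curlPair hg a c
    have hφdiv : VectorCalculus.IsDivFree φ :=
      isDivFree_curlPair_of_contDiff (hg.contDiff.of_le (by norm_cast)) a c
    have hφcont : Continuous φ := hφt.contDiff.continuous
    have hφc : HasCompactSupport φ := hφt.hasCompactSupport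
    -- the duality identity of the classical solution (no pressure hypothesis)
    have hIcc : Icc s t ⊆ Iio 0 := fun τ hτ => hτ.2.trans_lt ht
    have hbu : IsBoundedOn (Icc s t) u := ⟨M, fun τ hτ y => hbdM τ hτ.2 y⟩
    have hbf : IsBoundedOn (Icc s t) d := ⟨ε / Real.sqrt (-t) ^ 3, fun τ hτ y => hbdD τ hτ.2 y⟩
    have key := hcl.curlPair_duality_between hν hst.le hIcc hbu hbf hg a c hφ
    -- the three tested identities
    have e1 : ∫ x, ⟪H x, φ x⟫ = ∫ x, ⟪u s x, heatTest ν φ (t - s) x⟫ := by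
      rw [hH, integral_inner_heatExtension_comm_of_bound (hslice s (hst.trans ht)).aestronglyMeasurable
        (hbdM s hst.le) hφcont hφc hνts, heatTest_of_pos hν hst']
    have e2 : ∫ x, ⟪B x, φ x⟫ =
        -∫ τ in s..t, ∫ y, ⟪u τ y, convect (u τ) (heatTest ν φ (t - τ)) y⟫ :=
      integral_inner_oseenDuhamel_eq_neg_intervalIntegral hν hmeas hM0 huM hst le_rfl hφt hφdiv
    have e3 : ∫ x, ⟪Fd x, φ x⟫ = ∫ τ in s..t, ∫ y, ⟪d τ y, heatTest ν φ (t - τ) y⟫ :=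
      integral_inner_oseenForceDuhamel_of_isDivFree hν hdc hd hst ht
        (hφt.contDiff.of_le le_rfl) hφc hφdiv
    rw [hsplit φ hφcont hφc, key, e1, e2, e3]
    ring
  -- ## Liouville: `z` is constant
  obtain ⟨c, hc⟩ :=
    hz_div.exists_eq_const_of_continuous_of_forall_integral_inner_curlPair_eq_zero hz_c hz_bd hz_curl
  have hzc : ∀ x, z x = c := fun x => congrFun hc x
  -- ## the decay bounds the constant
  set e₁ : EuclideanSpace ℝ (Fin 3) := EuclideanSpace.single 0 1 with he₁
  set xs : ℕ → EuclideanSpace ℝ (Fin 3) := fun n => (n : ℝ) • e₁ with hxs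
  have hlim1 : Tendsto (fun n => u t (xs n)) atTop (𝓝 0) := by
    have h := tendsto_translate_axis_of_decay hsqt (hI t ht) 0
    simpa only [zero_add] using h
  have hlim2 : Tendsto (fun n => H (xs n)) atTop (𝓝 0) := by
    have hsqs : 0 < Real.sqrt (-s) := Real.sqrt_pos.2 (by linarith)
    have h := tendsto_heatExtension_of_tendsto_of_bound (f := fun n y => u s (y + xs n))
      (g := fun _ => (0 : EuclideanSpace ℝ (Fin 3)))
      (fun n => ((hslice s (hst.trans ht)).comp (continuous_id.add continuous_const)).aestronglyMeasurable)
      (fun n y => hbdM s hst.le _) (fun y => tendsto_translate_axis_of_decay hsqs (hI s (hst.trans ht)) y)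
      hνts 0
    simp only [heatExtension_comp_add_right', zero_add, UnboundedOperators.heatExtension_zero_fun,
      Pi.zero_apply] at h
    exact h
  have hlim3 : Tendsto (fun n => B (xs n)) atTop (𝓝 0) := by
    have h0m : AEStronglyMeasurable
        (uncurry (0 : ℝ → EuclideanSpace ℝ (Fin 3) → EuclideanSpace ℝ (Fin 3)))
        ((volume : Measure (ℝ × EuclideanSpace ℝ (Fin 3))).restrict (Ioo s t ×ˢ univ)) :=
      aestronglyMeasurable_const
    have h := tendsto_oseenDuhamel_of_tendsto_of_bound hν hM0 hst
      (u := fun n σ y => u σ (y + xs n)) (u₀ := 0)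
      (fun n => hmeas_tr (xs n)) h0m
      (fun n σ hσ y => hbdM σ hσ.2.le _)
      (fun σ hσ y => by
        have hsqσ : 0 < Real.sqrt (-σ) := Real.sqrt_pos.2 (by linarith [hσ.2])
        simpa only [Pi.zero_apply] using
          tendsto_translate_axis_of_decay hsqσ (hI σ (hσ.2.trans ht)) y) 0
    simp only [oseenDuhamel_comp_add_right', zero_add, oseenDuhamel_zero_left, Pi.zero_apply] at h
    exact h
  have hlimG : Tendsto (fun n => u t (xs n) - H (xs n) + B (xs n)) atTop (𝓝 (0 - 0 + 0)) :=
    (hlim1.sub hlim2).add hlim3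
  rw [sub_zero, add_zero] at hlimG
  -- `c = G(xs n) − Fd(xs n)` with `‖Fd‖ ≤ KF`
  have hcle : ‖c‖ ≤ KF := by
    have hev : ∀ n, ‖c‖ ≤ ‖u t (xs n) - H (xs n) + B (xs n)‖ + KF := fun n =>
      calc ‖c‖ = ‖z (xs n)‖ := by rw [hzc (xs n)]
        _ = ‖(u t (xs n) - H (xs n) + B (xs n)) - Fd (xs n)‖ := rfl
        _ ≤ ‖u t (xs n) - H (xs n) + B (xs n)‖ + ‖Fd (xs n)‖ := norm_sub_le _ _
        _ ≤ ‖u t (xs n) - H (xs n) + B (xs n)‖ + KF := by linarith [hFd_bd (xs n)]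
    have hlim : Tendsto (fun n => ‖u t (xs n) - H (xs n) + B (xs n)‖ + KF) atTop
        (𝓝 (‖(0 : EuclideanSpace ℝ (Fin 3))‖ + KF)) := hlimG.norm.add tendsto_const_nhds
    have h0 : ‖(0 : EuclideanSpace ℝ (Fin 3))‖ + KF = KF := by rw [norm_zero, zero_add]
    rw [h0] at hlim
    exact ge_of_tendsto' hlim hev
  refine ⟨c, hcle, fun x => ?_⟩
  have h1 := hzc x
  simp only [hz] at h1
  rw [← h1]
  abel

/-- **The `O(ε √lag)` forced-mild remainder of Type-I ancient classical solutions** (KNSS 2009,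
Lemma 3.1 / Remark 3.1, §4 (i) (4.5), proof of Thm. 6.1): under the hypotheses of
`exists_const_forced_oseenMild_of_typeI`, for all `s < t < 0` and every `x`,
`‖u(t,x) − e^{ν(t−s)Δ}u(s)(x) + B^ν_s(u,u)(t)(x)‖ ≤ 2κ ε √(t−s)/(√ν(−t))`. For `ε = 0` (no
force) this is the Oseen integral equation of the Type-I ancient solution.
[cite: KochNadirashviliSereginSverak2009, Lemma 3.1 / Remark 3.1 (p. 7), §4 (i) (4.3)–(4.5), proof of Thm. 6.1 last paragraph (p. 12)] -/
theorem exists_norm_sub_heatExtension_add_oseenDuhamel_le_of_typeI :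
    ∃ κ : ℝ, 0 < κ ∧ ∀ {ν C₀ ε : ℝ} {u d : ℝ → EuclideanSpace ℝ (Fin 3) → EuclideanSpace ℝ (Fin 3)}
      {p : ℝ → EuclideanSpace ℝ (Fin 3) → ℝ},
      IsClassicalNSSolutionOn (Iio 0) ν d u p → 0 < ν → HasTypeIDecay C₀ u →
      (∀ τ < 0, ∀ y, ‖d τ y‖ ≤ ε / (‖y‖ + Real.sqrt (-τ)) ^ 3) →
      ∀ ⦃s t : ℝ⦄, s < t → t < 0 → ∀ x,
        ‖u t x - UnboundedOperators.heatExtension (u s) (ν * (t - s)) x + oseenDuhamel ν s u u t x‖ ≤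
          2 * κ * ε * Real.sqrt (t - s) / (Real.sqrt ν * (-t)) := by
  obtain ⟨κ, hκ, h⟩ := exists_const_forced_oseenMild_of_typeI
  obtain ⟨κ', hκ', hF⟩ := exists_norm_oseenForceDuhamel_le_of_weight
  refine ⟨max κ κ', lt_max_of_lt_left hκ, fun {ν C₀ ε u d p} hcl hν hI hd s t hst ht x => ?_⟩
  obtain ⟨c, hc, hid⟩ := h hcl hν hI hd hst ht
  have hε : 0 ≤ ε := by
    have h1 := (norm_nonneg _).trans (hd (-1) (by norm_num) 0)
    have h2 : (0 : ℝ) < (‖(0 : (EuclideanSpace ℝ (Fin 3)))‖ + Real.sqrt (-(-1 : ℝ))) ^ 3 := by simp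
    exact (div_nonneg_iff.1 h1).elim (fun h => h.1) fun h => absurd h.2 (not_le.2 h2)
  have ht0 : 0 < -t := neg_pos.2 ht
  have hν' : 0 < Real.sqrt ν := Real.sqrt_pos.2 hν
  have hden : 0 < Real.sqrt ν * (-t) := mul_pos hν' ht0
  have hQ : 0 ≤ ε * Real.sqrt (t - s) / (Real.sqrt ν * (-t)) := by positivity
  rw [hid x]
  calc ‖oseenForceDuhamel ν s d t x + c‖ ≤ ‖oseenForceDuhamel ν s d t x‖ + ‖c‖ := norm_add_le _ _
    _ ≤ κ' * ε * Real.sqrt (t - s) / (Real.sqrt ν * (-t)) + κ * ε * Real.sqrt (t - s) / (Real.sqrt ν * (-t)) :=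
        add_le_add (hF hν d hd hst ht x) hc
    _ = (κ' + κ) * (ε * Real.sqrt (t - s) / (Real.sqrt ν * (-t))) := by ring
    _ ≤ (2 * max κ κ') * (ε * Real.sqrt (t - s) / (Real.sqrt ν * (-t))) := by
        gcongr
        linarith [le_max_left κ κ', le_max_right κ κ']
    _ = 2 * max κ κ' * ε * Real.sqrt (t - s) / (Real.sqrt ν * (-t)) := by ring

/-- **Engine form (`ν = 1`)**: there are a profile `Φ`, monotone and nonnegative on `(−∞, 0)`
(`Φ(t) = 2κ/(−t)`), and a kernel `K` (`K(s,t) = 2κ√(t−s)/(−t)`) such that every classical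
solution of the Navier–Stokes system with unit viscosity and force `d` on `ℝ³ × (−∞,0)` with the
Type-I bound (constant `C₀`) and the defect bound `‖d(τ,y)‖ ≤ ε/(‖y‖ + √(−τ))³` satisfies, for
all `s < t < 0` and all `x`,
`‖u(t,x) − e^{(t−s)Δ}u(s)(x) + B¹_s(u,u)(t)(x)‖ ≤ ε K(s,t)` and, for `t − s ≤ 1`,
`≤ ε Φ(t) √(t−s)` (the two clauses are the same bound). This is the shape consumed by the forced
ancient-mild compactness engine. [cite: KochNadirashviliSereginSverak2009, Lemma 3.1 / Remark 3.1 (p. 7), §4 (i) (4.3)–(4.5), proof of Thm. 6.1 last paragraph (p. 12)] -/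
theorem forcedOseenMild_remainder_typeI :
    ∃ (Φ : ℝ → ℝ) (K : ℝ → ℝ → ℝ), MonotoneOn Φ (Iio 0) ∧ (∀ τ < 0, 0 ≤ Φ τ) ∧
      ∀ {C₀ ε : ℝ} {u d : ℝ → EuclideanSpace ℝ (Fin 3) → EuclideanSpace ℝ (Fin 3)}
        {p : ℝ → EuclideanSpace ℝ (Fin 3) → ℝ},
        IsClassicalNSSolutionOn (Iio 0) 1 d u p → HasTypeIDecay C₀ u →
        (∀ τ < 0, ∀ y, ‖d τ y‖ ≤ ε / (‖y‖ + Real.sqrt (-τ)) ^ 3) →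
        ∀ s t : ℝ, s < t → t < 0 → ∀ x,
          ‖u t x - UnboundedOperators.heatExtension (u s) (t - s) x + oseenDuhamel 1 s u u t x‖ ≤
              ε * K s t ∧
            (t - s ≤ 1 →
              ‖u t x - UnboundedOperators.heatExtension (u s) (t - s) x + oseenDuhamel 1 s u u t x‖ ≤
                ε * Φ t * Real.sqrt (t - s)) := by
  obtain ⟨κ, hκ, h⟩ := exists_norm_sub_heatExtension_add_oseenDuhamel_le_of_typeI
  refine ⟨fun t => 2 * κ / (-t), fun s t => 2 * κ * Real.sqrt (t - s) / (-t), ?_, ?_,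
    fun {C₀ ε u d p} hcl hI hd s t hst ht x => ?_⟩
  · intro a ha b hb hab
    have ha' : 0 < -a := neg_pos.2 ha
    have hb' : 0 < -b := neg_pos.2 hb
    exact div_le_div_of_nonneg_left (by positivity) hb' (by linarith)
  · intro t ht
    have ht' : 0 < -t := neg_pos.2 ht
    positivity
  · have h1 := h hcl one_pos hI hd hst ht x
    rw [one_mul, Real.sqrt_one, one_mul] at h1
    refine ⟨?_, fun _ => ?_⟩
    · calc _ ≤ 2 * κ * ε * Real.sqrt (t - s) / (-t) := h1
        _ = ε * (2 * κ * Real.sqrt (t - s) / (-t)) := by ring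
    · calc _ ≤ 2 * κ * ε * Real.sqrt (t - s) / (-t) := h1
        _ = ε * (2 * κ / (-t)) * Real.sqrt (t - s) := by ring

end Main

/-! ### The exact forced Oseen identity (the drift constant vanishes) -/

section Exact

variable {ν C₀ ε : ℝ} {u d : ℝ → EuclideanSpace ℝ (Fin 3) → EuclideanSpace ℝ (Fin 3)}
  {p : ℝ → EuclideanSpace ℝ (Fin 3) → ℝ}

/-- The unforced remainder `u(t) − e^{ν(t−s)Δ}u(s) + B^ν_s(u,u)(t)` of a Type-I ancient classical
solution tends to zero along the axis points `n e₁` (Type I for `u(t)`; dominated convergence of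
the translates for the caloric and Duhamel terms). [cite: KochNadirashviliSereginSverak2009, proof of Thm. 6.1, last paragraph (arXiv p. 12)] -/
private theorem tendsto_remainder_translate_axis {f : ℝ → EuclideanSpace ℝ (Fin 3) → EuclideanSpace ℝ (Fin 3)}
    (hcl : IsClassicalNSSolutionOn (Iio 0) ν f u p) (hν : 0 < ν) (hI : HasTypeIDecay C₀ u)
    {s t : ℝ} (hst : s < t) (ht : t < 0) :
    Tendsto (fun n : ℕ =>
      u t ((n : ℝ) • (EuclideanSpace.single 0 1 : EuclideanSpace ℝ (Fin 3))) -
        UnboundedOperators.heatExtension (u s) (ν * (t - s))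
          ((n : ℝ) • (EuclideanSpace.single 0 1 : EuclideanSpace ℝ (Fin 3))) +
        oseenDuhamel ν s u u t ((n : ℝ) • (EuclideanSpace.single 0 1 : EuclideanSpace ℝ (Fin 3))))
      atTop (𝓝 0) := by
  haveI : CompleteSpace (EuclideanSpace ℝ (Fin 3)) := FiniteDimensional.complete ℝ _
  have ht0 : 0 < -t := neg_pos.2 ht
  have hst' : 0 < t - s := sub_pos.2 hst
  have hνts : 0 < ν * (t - s) := mul_pos hν hst'
  have hsqt : 0 < Real.sqrt (-t) := Real.sqrt_pos.2 ht0
  have hC₀ : 0 ≤ C₀ := by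
    have h := (norm_nonneg _).trans (hI t ht 0)
    rw [norm_zero, zero_add] at h
    exact (div_nonneg_iff.1 h).elim (fun h => h.1) fun h => absurd h.2 (not_le.2 hsqt)
  set M : ℝ := C₀ / Real.sqrt (-t) with hM
  have hM0 : 0 ≤ M := by positivity
  have hbdM : ∀ τ, τ ≤ t → ∀ y, ‖u τ y‖ ≤ M := by
    intro τ hτ y
    have hτ0 : τ < 0 := hτ.trans_lt ht
    have hsq : Real.sqrt (-t) ≤ Real.sqrt (-τ) := Real.sqrt_le_sqrt (by linarith)
    calc ‖u τ y‖ ≤ C₀ / (‖y‖ + Real.sqrt (-τ)) := hI τ hτ0 y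
      _ ≤ C₀ / Real.sqrt (-t) :=
          div_le_div_of_nonneg_left hC₀ hsqt (by linarith [norm_nonneg y])
  have hcont : ContinuousOn (uncurry u) (Iio 0 ×ˢ univ) := hcl.smooth_velocity.continuousOn
  have hslice : ∀ τ < 0, Continuous (u τ) := fun τ hτ =>
    hcont.comp_continuous (Continuous.prodMk_right τ) fun x => ⟨hτ, mem_univ x⟩
  have hmeas_tr : ∀ (x' : EuclideanSpace ℝ (Fin 3)),
      AEStronglyMeasurable (uncurry fun σ y => u σ (y + x'))
        ((volume : Measure (ℝ × EuclideanSpace ℝ (Fin 3))).restrict (Ioo s t ×ˢ univ)) := by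
    intro x'
    have hc : ContinuousOn (uncurry fun σ y => u σ (y + x')) (Ioo s t ×ˢ univ) := by
      refine (hcont.comp (continuous_fst.prodMk (continuous_snd.add continuous_const)).continuousOn
        fun q hq => ⟨?_, mem_univ _⟩)
      exact (show q.1 < t from hq.1.2).trans ht
    exact hc.aestronglyMeasurable (measurableSet_Ioo.prod MeasurableSet.univ)
  set e₁ : EuclideanSpace ℝ (Fin 3) := EuclideanSpace.single 0 1 with he₁
  set xs : ℕ → EuclideanSpace ℝ (Fin 3) := fun n => (n : ℝ) • e₁ with hxs
  have hlim1 : Tendsto (fun n => u t (xs n)) atTop (𝓝 0) := by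
    have h := tendsto_translate_axis_of_decay hsqt (hI t ht) 0
    simpa only [zero_add] using h
  have hlim2 : Tendsto (fun n => UnboundedOperators.heatExtension (u s) (ν * (t - s)) (xs n))
      atTop (𝓝 0) := by
    have hsqs : 0 < Real.sqrt (-s) := Real.sqrt_pos.2 (by linarith)
    have h := tendsto_heatExtension_of_tendsto_of_bound (f := fun n y => u s (y + xs n))
      (g := fun _ => (0 : EuclideanSpace ℝ (Fin 3)))
      (fun n => ((hslice s (hst.trans ht)).comp (continuous_id.add continuous_const)).aestronglyMeasurable)
      (fun n y => hbdM s hst.le _) (fun y => tendsto_translate_axis_of_decay hsqs (hI s (hst.trans ht)) y)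
      hνts 0
    simp only [heatExtension_comp_add_right', zero_add, UnboundedOperators.heatExtension_zero_fun,
      Pi.zero_apply] at h
    exact h
  have hlim3 : Tendsto (fun n => oseenDuhamel ν s u u t (xs n)) atTop (𝓝 0) := by
    have h0m : AEStronglyMeasurable
        (uncurry (0 : ℝ → EuclideanSpace ℝ (Fin 3) → EuclideanSpace ℝ (Fin 3)))
        ((volume : Measure (ℝ × EuclideanSpace ℝ (Fin 3))).restrict (Ioo s t ×ˢ univ)) :=
      aestronglyMeasurable_const
    have h := tendsto_oseenDuhamel_of_tendsto_of_bound hν hM0 hst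
      (u := fun n σ y => u σ (y + xs n)) (u₀ := 0)
      (fun n => hmeas_tr (xs n)) h0m
      (fun n σ hσ y => hbdM σ hσ.2.le _)
      (fun σ hσ y => by
        have hsqσ : 0 < Real.sqrt (-σ) := Real.sqrt_pos.2 (by linarith [hσ.2])
        simpa only [Pi.zero_apply] using
          tendsto_translate_axis_of_decay hsqσ (hI σ (hσ.2.trans ht)) y) 0
    simp only [oseenDuhamel_comp_add_right', zero_add, oseenDuhamel_zero_left, Pi.zero_apply] at h
    exact h
  have hlimG := (hlim1.sub hlim2).add hlim3
  rw [sub_zero, add_zero] at hlimG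
  exact hlimG

/-- **Type-I ancient classical solutions with a defect force are forced Oseen-mild, exactly**
(KNSS 2009, Lemma 3.1 / Remark 3.1 with §4 (i) and the last paragraph of the proof of Thm. 6.1:
the drift `b` vanishes by the decay): for a classical solution `(u, p)` with viscosity `ν > 0`
and force `d` on `ℝ³ × (−∞, 0)` satisfying the Type-I bound `‖u(t,x)‖ ≤ C₀/(‖x‖ + √(−t))` and
the defect bound `‖d(τ,y)‖ ≤ ε/(‖y‖ + √(−τ))³`, for all `s < t < 0` and every `x`,
`u(t, x) − e^{ν(t−s)Δ}u(s)(x) + B^ν_s(u,u)(t)(x) = (∫ₛᵗ e^{ν(t−τ)Δ}ℙ d(τ) dτ)(x)`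
(`= oseenForceDuhamel ν s d t x`): both sides differ by a constant
(`exists_const_forced_oseenMild_of_typeI`) and tend to zero along `n e₁`.
[cite: KochNadirashviliSereginSverak2009, Lemma 3.1 / Remark 3.1 (p. 7), §4 (i) (4.3)–(4.5), proof of Thm. 6.1 last paragraph (p. 12)] -/
theorem forced_oseenMild_of_typeI (hcl : IsClassicalNSSolutionOn (Iio 0) ν d u p) (hν : 0 < ν)
    (hI : HasTypeIDecay C₀ u) (hd : ∀ τ < 0, ∀ y, ‖d τ y‖ ≤ ε / (‖y‖ + Real.sqrt (-τ)) ^ 3)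
    {s t : ℝ} (hst : s < t) (ht : t < 0) (x : EuclideanSpace ℝ (Fin 3)) :
    u t x - UnboundedOperators.heatExtension (u s) (ν * (t - s)) x + oseenDuhamel ν s u u t x =
      oseenForceDuhamel ν s d t x := by
  obtain ⟨κ, -, h⟩ := exists_const_forced_oseenMild_of_typeI
  obtain ⟨c, -, hid⟩ := h hcl hν hI hd hst ht
  have hdc : ContinuousOn (uncurry d) (Iio 0 ×ˢ univ) := hcl.continuousOn_force (uniqueDiffOn_Iio 0)
  have hG := tendsto_remainder_translate_axis hcl hν hI hst ht
  have hF := tendsto_oseenForceDuhamel_translate_axis hν hdc hd s ht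
  have hc : Tendsto (fun _ : ℕ => c) atTop (𝓝 ((0 : EuclideanSpace ℝ (Fin 3)) - 0)) := by
    refine (hG.sub hF).congr fun n => ?_
    rw [hid]
    abel
  rw [sub_zero] at hc
  have hc0 : c = 0 := tendsto_nhds_unique tendsto_const_nhds hc
  rw [hid x, hc0, add_zero]

/-- **The `O(ε √lag)` remainder with the sharp constant** (the force term itself):
`‖u(t,x) − e^{ν(t−s)Δ}u(s)(x) + B^ν_s(u,u)(t)(x)‖ ≤ κ ε √(t−s)/(√ν(−t))` with the `κ` of
`exists_norm_oseenForceDuhamel_le_of_weight`. [cite: KochNadirashviliSereginSverak2009, Lemma 3.1 / Remark 3.1 (p. 7), §4 (i) (4.3)–(4.5), proof of Thm. 6.1 last paragraph (p. 12)] -/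
theorem exists_norm_sub_heatExtension_add_oseenDuhamel_le_of_typeI' :
    ∃ κ : ℝ, 0 < κ ∧ ∀ {ν C₀ ε : ℝ} {u d : ℝ → EuclideanSpace ℝ (Fin 3) → EuclideanSpace ℝ (Fin 3)}
      {p : ℝ → EuclideanSpace ℝ (Fin 3) → ℝ},
      IsClassicalNSSolutionOn (Iio 0) ν d u p → 0 < ν → HasTypeIDecay C₀ u →
      (∀ τ < 0, ∀ y, ‖d τ y‖ ≤ ε / (‖y‖ + Real.sqrt (-τ)) ^ 3) →
      ∀ ⦃s t : ℝ⦄, s < t → t < 0 → ∀ x,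
        ‖u t x - UnboundedOperators.heatExtension (u s) (ν * (t - s)) x + oseenDuhamel ν s u u t x‖ ≤
          κ * ε * Real.sqrt (t - s) / (Real.sqrt ν * (-t)) := by
  obtain ⟨κ, hκ, hF⟩ := exists_norm_oseenForceDuhamel_le_of_weight
  refine ⟨κ, hκ, fun {ν C₀ ε u d p} hcl hν hI hd s t hst ht x => ?_⟩
  rw [forced_oseenMild_of_typeI hcl hν hI hd hst ht x]
  exact hF hν d hd hst ht x

end Exact

end Literature.Analysis.FluidPDE

end
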